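import Literature.NumberTheory.EllipticCurves.GrossZagierRationalPoint
import Literature.NumberTheory.EllipticCurves.BSDRootNumberSmallConductorAssemblyProofs
import Literature.NumberTheory.EllipticCurves.GaloisAction
import Literature.NumberTheory.EllipticCurves.GlobalMinimalModel
import HarnessLib

/-!
# Line `fkl` of crux `RankOneAtTwoBigImageOddLocal` (stmt-BirchSwinnertonDyer-23715, route ByReductionTypeAtTwo):
# stub (5a) `stub_shaAnRationalOnSlice` — `Ш_an ∈ ℚ^×` in analytic rank one, from its two printed inputs

Width prover seat `bsd-line-fkl-p2` (g0) under the lead `bsd-line-fkl-p1`; helper file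
`--supports stmt-BirchSwinnertonDyer-23715` for the registered stub (skeleton v2/v3 `Lines/fkl.lean`)

  `theorem stub_shaAnRationalOnSlice : ∀ (W : WeierstrassCurve ℚ) [W.IsElliptic] [W.IsGloballyMinimal],
      (∀ n : ℕ, W.HasSurjectiveModNGaloisRep ((2 ^ n : ℕ) : ℤ)) → Odd W.torsionOrder → Odd W.tamagawaProduct →
      W.analyticRank = 1 → ∃ q : ℚ, shaAn W = (q : ℂ) ∧ q ≠ 0`.

This is a PRINT-assembly stub: its content is Gross–Zagier 1986, Thm. I.(7.3) (Invent. Math. 84, p. 231; proof V.§2,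
pp. 310–313: «if `L(E,1) = 0 ≠ L'(E,1)` and `rank E(ℚ) = 1`, then `L'(E,1) = c_E · Ω · R` with `c_E ∈ ℚ^×`»; tree named
fact `Literature.NumberTheory.EllipticCurves.GrossZagier1986_thm_I_7_3`, file `GrossZagierRationalPoint.lean`) together with
Gross–Zagier–Kolyvagin (`rank E(ℚ) = ord_{s=1} L(E,s)` when the latter is `≤ 1`; tree named fact
`rank_eq_analyticRank_of_analyticRank_le_one` = bsd.S17, which is ALSO the first conjunct of the line's stub (1)
`stub_fklPub`).  Given these, `#Ш_an = L'(E,1) · #E(ℚ)_tors² / (Ω · ∏ c_ℓ · Reg) = c_E · #E(ℚ)_tors² / ∏ c_ℓ`, a non-zero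
rational number (`#E(ℚ)_tors ≥ 1`, `∏ c_ℓ ≥ 1`, both PROVED in the tree).  Accordingly this file lands

1. `shaAn_eq_ratCast_of_leadingLCoeff_eq` — the bookkeeping identity: `L^{(r)}(E,1)/r! = c · Ω · Reg` (`c ∈ ℚ`) gives
   `shaAn W = c · #E(ℚ)_tors² / ∏ c_ℓ` as a rational number (any elliptic `W/ℚ`, no rank hypothesis);
2. `exists_rat_shaAn_eq_and_ne_zero_of_mordellWeilRank_eq_one` (per curve: analytic rank `1` ∧ `rank E(ℚ) = 1`,
   conditional on GZ86 I.(7.3) alone) and `exists_rat_shaAn_eq_and_ne_zero_of_analyticRank_eq_one` — for EVERY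
   elliptic `W/ℚ` of analytic rank one, `Ш_an(W) ∈ ℚ^×`, conditional on exactly {GZ86 I.(7.3), GZK}: the slice binders
   of the stub (big `2`-adic image, odd torsion, odd Tamagawa product, global minimality) are idle for (5a);
3. `stub_shaAnRationalOnSlice_of_facts` — the registered signature VERBATIM behind the same two named facts
   (the lead instantiates `hGZK` with `stub_fklPub.1`);
4. `padicValRat_two_eq_of_shaAn_eq_of_odd` — what the witness is worth for the neighbouring OPEN stub (5b) (not proved,
   not restated here): on the slice (`#E(ℚ)_tors` odd, `∏ c_ℓ` odd) `ord₂ Ш_an = ord₂ c_E` for the Gross–Zagier constant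
   `c_E = L'(E,1)/(Ω · Reg)`, i.e. the `2`-integrality of `Ш_an` on the slice is exactly the `2`-integrality of `c_E`;
5. `shaAn_ratCast_pos_of_facts` — the sign, for consumers who want `0 < q` rather than `q ≠ 0` (extra inputs: modularity
   `hasEntireLFunction_rat`, `L(E,1) ≥ 0` `re_entireLFunction_one_nonneg`, and the positive-constant form
   `gross_zagier_rank_one_rat`; tree theorem `shaAn_re_pos_of_analyticRank_le_one'`).

Honest status: (5a) is CLOSED MODULO the two printed named facts {`GrossZagier1986_thm_I_7_3`,
`rank_eq_analyticRank_of_analyticRank_le_one`}; neither has a `_holds` in the tree (Gross–Zagier's formula and Kolyvagin's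
Euler system are not formalised), so the stub as registered is «stub-blocked» on them, exactly as the line card expects
(«closed by citation»).  Nothing is asserted: theorems only, no `def`, no new named fact, no `sorry`.
BSD is not proved by any of this.

References: [GrossZagier1986] B. H. Gross, D. B. Zagier, Invent. Math. 84 (1986), Thm. I.(7.3) p. 231, V.§2 pp. 310–313
(corpus `paper:url-d19484107fe2`, pp. 7, 107, 112); [Darmon2004] H. Darmon, CBMS 101, Thm. 3.22 (GZK);
[Miller2011LMS] R. L. Miller, LMS J. Comput. Math. 14 (2011), §1 (`#Ш_an`).
-/

noncomputable section

open scoped Classical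

-- `Summit.BirchSwinnertonDyer.BirchSwinnertonDyer.…` repeats the summit name by the tree's layout (single-conjunct summit).
set_option linter.dupNamespace false

namespace Summit.BirchSwinnertonDyer.BirchSwinnertonDyer.Theorems.RankOneAtTwoFkl

open WeierstrassCurve Literature.NumberTheory.EllipticCurves

/-- **Bookkeeping identity.** If the BSD leading coefficient of an elliptic `W/ℚ` is `c · Ω(W) · Reg(W)` for a rational
`c` (the shape of Gross–Zagier 1986 (7.2)/(7.3) 2)), then Miller's analytic order of `Ш` is the rational number
`c · #E(ℚ)_tors² / ∏ c_ℓ`:  `shaAn W = L^{(r)}(E,1)/r! · #T² / (Ω · ∏ c_ℓ · Reg)` and `Ω > 0`, `Reg > 0` cancel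
(`realPeriodRat_pos_holds`, `regulator_pos'`; `∏ c_ℓ > 0` by `tamagawaProduct_pos'`).
[cite: GrossZagier1986, (7.2) and Thm. I.(7.3) 2) (p. 231)] [cite: Miller2011LMS, §1 (arXiv:1010.2431 p. 3)] -/
theorem shaAn_eq_ratCast_of_leadingLCoeff_eq (W : WeierstrassCurve ℚ) [W.IsElliptic] {c : ℚ}
    (hcL : W.leadingLCoeff = (((c : ℝ) * W.realPeriodRat * W.regulator : ℝ) : ℂ)) :
    shaAn W = ((c * (W.torsionOrder : ℚ) ^ 2 / (W.tamagawaProduct : ℚ) : ℚ) : ℂ) := by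
  have hΩ : (W.realPeriodRat : ℂ) ≠ 0 := by exact_mod_cast W.realPeriodRat_pos_holds.ne'
  have hR : (W.regulator : ℂ) ≠ 0 := by exact_mod_cast W.regulator_pos'.ne'
  have hc : (W.tamagawaProduct : ℂ) ≠ 0 := by exact_mod_cast W.tamagawaProduct_pos'.ne'
  rw [shaAn_def, hcL]
  push_cast
  field_simp

/-- **Per-curve form, conditional on Gross–Zagier 1986 Thm. I.(7.3) alone.**  If `ord_{s=1} L(E,s) = 1` and
`rank E(ℚ) = 1` is known for THIS curve (from whatever source — Kolyvagin, or a `2`-descent on the slice), then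
`Ш_an(W) ∈ ℚ^×`.  [cite: GrossZagier1986, Thm. I.(7.3) 2) (p. 231)] -/
theorem exists_rat_shaAn_eq_and_ne_zero_of_mordellWeilRank_eq_one (hGZ : GrossZagier1986_thm_I_7_3)
    (W : WeierstrassCurve ℚ) [W.IsElliptic] (hr : W.analyticRank = 1) (hrk : W.mordellWeilRank = 1) :
    ∃ q : ℚ, shaAn W = (q : ℂ) ∧ q ≠ 0 := by
  obtain ⟨c, hc0, hcL⟩ := leadingLCoeff_eq_rat_mul_of_analyticRank_eq_one (W := W) hGZ hr hrk
  refine ⟨c * (W.torsionOrder : ℚ) ^ 2 / (W.tamagawaProduct : ℚ), shaAn_eq_ratCast_of_leadingLCoeff_eq W hcL, ?_⟩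
  have hT : (W.torsionOrder : ℚ) ≠ 0 := by exact_mod_cast W.torsionOrder_pos_holds.ne'
  have hc : (W.tamagawaProduct : ℚ) ≠ 0 := by exact_mod_cast W.tamagawaProduct_pos'.ne'
  exact div_ne_zero (mul_ne_zero hc0 (pow_ne_zero 2 hT)) hc

/-- **`Ш_an ∈ ℚ^×` in analytic rank one, for every elliptic curve over `ℚ`** — from Gross–Zagier 1986, Thm. I.(7.3) 2)
(`hGZ`: `L'(E,1) = c_E · Ω · Reg`, `c_E ∈ ℚ^×`, given `rank E(ℚ) = 1`) and Gross–Zagier–Kolyvagin (`hGZK`: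
`rank E(ℚ) = ord_{s=1} L(E,s) = 1`): `Ш_an = c_E · #E(ℚ)_tors² / ∏ c_ℓ ≠ 0`.  No minimality, image, torsion or Tamagawa
hypothesis is needed.  (Rationality alone, without the non-vanishing, is the tree's
`Disegni2020.exists_rat_shaAn_eq_of_analyticRank_eq_one`.)
[cite: GrossZagier1986, Thm. I.(7.3) 2) (p. 231); V.§2 (pp. 310–313)] [cite: Darmon2004, Thm. 3.22] -/
theorem exists_rat_shaAn_eq_and_ne_zero_of_analyticRank_eq_one (hGZ : GrossZagier1986_thm_I_7_3)
    (hGZK : rank_eq_analyticRank_of_analyticRank_le_one) (W : WeierstrassCurve ℚ) [W.IsElliptic]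
    (hr : W.analyticRank = 1) : ∃ q : ℚ, shaAn W = (q : ℂ) ∧ q ≠ 0 := by
  obtain ⟨hrank, -⟩ := hGZK W (by omega)
  exact exists_rat_shaAn_eq_and_ne_zero_of_mordellWeilRank_eq_one hGZ W hr (by omega)

/-- **Stub (5a) of line `fkl`, verbatim, behind its two printed inputs.**  The registered signature of
`stub_shaAnRationalOnSlice` (crux `RankOneAtTwoBigImageOddLocal`, skeleton `Lines/fkl.lean`) follows from
Gross–Zagier 1986 Thm. I.(7.3) (`hGZ`) and Gross–Zagier–Kolyvagin (`hGZK`, = `stub_fklPub.1` in the skeleton); the slice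
binders are not used.  Status: CONDITIONAL on these two named facts (no `_holds` in the tree for either).
[cite: GrossZagier1986, Thm. I.(7.3) (p. 231)] [cite: Darmon2004, Thm. 3.22] -/
theorem stub_shaAnRationalOnSlice_of_facts (hGZ : GrossZagier1986_thm_I_7_3)
    (hGZK : rank_eq_analyticRank_of_analyticRank_le_one) :
    ∀ (W : WeierstrassCurve ℚ) [W.IsElliptic] [W.IsGloballyMinimal],
      (∀ n : ℕ, W.HasSurjectiveModNGaloisRep ((2 ^ n : ℕ) : ℤ)) → Odd W.torsionOrder → Odd W.tamagawaProduct →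
      W.analyticRank = 1 → ∃ q : ℚ, shaAn W = (q : ℂ) ∧ q ≠ 0 :=
  fun W _ _ _ _ _ han => exists_rat_shaAn_eq_and_ne_zero_of_analyticRank_eq_one hGZ hGZK W han

/-- **What the witness is worth at `2` on the slice.**  If `L^{(r)}(E,1)/r! = c · Ω · Reg` with `c ∈ ℚ` and
`Ш_an(W) = q ∈ ℚ`, and `#E(ℚ)_tors` and `∏ c_ℓ` are ODD (the slice of crux `RankOneAtTwoBigImageOddLocal`), then
`ord₂ q = ord₂ c`: by `shaAn_eq_ratCast_of_leadingLCoeff_eq`, `q = c · #T² / ∏ c_ℓ` and the odd factors have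
`2`-adic valuation `0`.  So the neighbouring open stub (5b) («`0 ≤ ord₂ Ш_an`» on the slice) is, curve by curve, the
`2`-integrality of the Gross–Zagier constant `c_E = L'(E,1)/(Ω · Reg)` of (7.2).  (For `c = 0`, i.e. off analytic rank
`≤ 1` uses, both sides are `0`.) [cite: GrossZagier1986, (7.2) and Thm. I.(7.3) 2) (p. 231)] -/
theorem padicValRat_two_eq_of_shaAn_eq_of_odd (W : WeierstrassCurve ℚ) [W.IsElliptic] {c q : ℚ}
    (hcL : W.leadingLCoeff = (((c : ℝ) * W.realPeriodRat * W.regulator : ℝ) : ℂ)) (hq : shaAn W = (q : ℂ))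
    (hT : Odd W.torsionOrder) (hc : Odd W.tamagawaProduct) : padicValRat 2 q = padicValRat 2 c := by
  have hq' : q = c * (W.torsionOrder : ℚ) ^ 2 / (W.tamagawaProduct : ℚ) := by
    have h := hq.symm.trans (shaAn_eq_ratCast_of_leadingLCoeff_eq W hcL)
    exact_mod_cast h
  have hT0 : (W.torsionOrder : ℚ) ≠ 0 := by exact_mod_cast W.torsionOrder_pos_holds.ne'
  have hc0 : (W.tamagawaProduct : ℚ) ≠ 0 := by exact_mod_cast W.tamagawaProduct_pos'.ne'
  have hvT : padicValRat 2 (W.torsionOrder : ℚ) = 0 := by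
    rw [padicValRat.of_nat, Nat.cast_eq_zero]
    exact padicValNat.eq_zero_of_not_dvd (fun h => (Nat.not_even_iff_odd.mpr hT) (even_iff_two_dvd.mpr h))
  have hvc : padicValRat 2 (W.tamagawaProduct : ℚ) = 0 := by
    rw [padicValRat.of_nat, Nat.cast_eq_zero]
    exact padicValNat.eq_zero_of_not_dvd (fun h => (Nat.not_even_iff_odd.mpr hc) (even_iff_two_dvd.mpr h))
  by_cases hcz : c = 0
  · subst hcz
    simp [hq']
  · rw [hq', padicValRat.div (mul_ne_zero hcz (pow_ne_zero 2 hT0)) hc0,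
      padicValRat.mul hcz (pow_ne_zero 2 hT0), padicValRat.pow (W.torsionOrder : ℚ), hvT, hvc]
    ring

/-- **The sign of the witness.**  On top of rationality, `Ш_an(W) > 0` in analytic rank `≤ 1` is a theorem of the tree
modulo modularity (`hasEntireLFunction_rat`), `L(E,1) ≥ 0` (`re_entireLFunction_one_nonneg`) and the positive-constant
form of Gross–Zagier (`gross_zagier_rank_one_rat`) — `shaAn_re_pos_of_analyticRank_le_one'`; so with GZ86 I.(7.3) and
GZK the rational witness is POSITIVE.  Recorded for consumers that want `0 < q`; stub (5a) itself only needs `q ≠ 0`.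
[cite: GrossZagier1986, Thm. I.6.3, Thm. I.(7.3) and §V.2] [cite: Miller2011LMS, §1 and §4] -/
theorem shaAn_ratCast_pos_of_facts (hGZ : GrossZagier1986_thm_I_7_3)
    (hGZK : rank_eq_analyticRank_of_analyticRank_le_one) (hmod : hasEntireLFunction_rat)
    (hL0 : re_entireLFunction_one_nonneg) (hGZpos : gross_zagier_rank_one_rat) (W : WeierstrassCurve ℚ)
    [W.IsElliptic] (hr : W.analyticRank = 1) : ∃ q : ℚ, shaAn W = (q : ℂ) ∧ 0 < q := by
  obtain ⟨q, hq, -⟩ := exists_rat_shaAn_eq_and_ne_zero_of_analyticRank_eq_one hGZ hGZK W hr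
  refine ⟨q, hq, ?_⟩
  have hpos : 0 < (shaAn W).re := shaAn_re_pos_of_analyticRank_le_one' W hmod hL0 hGZpos (by omega) ⟨q, hq⟩
  rw [hq] at hpos
  exact_mod_cast (by simpa using hpos)

end Summit.BirchSwinnertonDyer.BirchSwinnertonDyer.Theorems.RankOneAtTwoFkl

end
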